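import Mathlib
import Summits.Ventures.Crystal3D.Theorems.StickyWulffConstantLayerChainDefs
import HarnessLib

/-!
# Continuity and boundedness of the homogenised stacking tension `stackTension f n`
# (line `LayerChain` v4 of the crux `StackingLiminf`, stmt-Ventures-19145 — analysis behind
# stub (A) `stub_modulatedWulff`)

Route `StickyWulffConstant` of the venture `Summits/Ventures/Crystal3D` (cell `crystal3d-full`).
Objects: `stackPhi f n τ = Φ_f(n, τ)` (lifted cell function), `stackTension f n = ⨅ τ, Φ_f(n, τ)`
and `stackWulff f = W_f` of `StickyWulffConstantLayerChainDefs` (p473239).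

* `stackTension_nonneg`, `stackTension_le_stackPhi`, `stackTension_zero_right`,
  `dot3_le_stackTension` (`u ∈ W_f ⇒ u·n ≤ φ_f(n)`: `W_f` lies in every half-space of its
  support function — the only property of `W_f` the modulated Wulff inequality uses);
* **`stackTension_le_stackTension_add`** — the explicit modulus
  `φ_f(n) ≤ φ_{f'}(n') + Σᵢ (|n·aᵢ − n'·aᵢ| + |(1−f) n·b⁺ᵢ − (1−f') n'·b⁺ᵢ| + |f n·b⁻ᵢ − f' n'·b⁻ᵢ|)`,
  proved by REPARAMETRISING the corrector slope: in the variable `s = (1−f) f τ` the cell function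
  is `Σ|n·aᵢ| + Σ|(1−f) n·b⁺ᵢ + s| + Σ|f n·b⁻ᵢ − s|`, which is 1-Lipschitz in the data UNIFORMLY in
  `s`; at the degenerate densities `f ∈ {0, 1}` (where `τ` disappears) the missing infimum over `s`
  is harmless because `|p| + |m| ≤ |p + s| + |m − s|` whenever `p = 0` or `m = 0`;
* **`continuous_stackTension`** — `(f, n) ↦ φ_f(n)` is (jointly) continuous on `ℝ × ℝ³`;
* `norm_le_nine_of_mem_stackWulff` — `W_f ⊆ B̄_∞(0, 9)` for `f ∈ [0, 1]`.
WHAT THIS IS NOT: not the stub; nothing discrete; rung F-C1 not moved.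
-/

noncomputable section

namespace Summit.Ventures.Crystal3D.Theorems.ModulatedWulff

open Summit.Ventures.Crystal3D.LayerChain (dot3 aVec bPlus bMinus stackPhi stackTension stackWulff)
open Filter Topology

/-! ### Order facts about `Φ_f` and `φ_f = inf_τ Φ_f` -/

/-- The lifted cell function is nonnegative. -/
theorem stackPhi_nonneg (f : ℝ) (n : Fin 3 → ℝ) (τ : ℝ) : 0 ≤ stackPhi f n τ := by
  unfold stackPhi
  positivity

/-- `τ ↦ Φ_f(n, τ)` is bounded below (by `0`). -/
theorem bddBelow_range_stackPhi (f : ℝ) (n : Fin 3 → ℝ) :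
    BddBelow (Set.range fun τ : ℝ => stackPhi f n τ) :=
  ⟨0, by rintro _ ⟨τ, rfl⟩; exact stackPhi_nonneg f n τ⟩

/-- `φ_f(n) ≤ Φ_f(n, τ)` for every slope `τ`. -/
theorem stackTension_le_stackPhi (f : ℝ) (n : Fin 3 → ℝ) (τ : ℝ) :
    stackTension f n ≤ stackPhi f n τ :=
  ciInf_le (bddBelow_range_stackPhi f n) τ

/-- The tension is nonnegative. -/
theorem stackTension_nonneg (f : ℝ) (n : Fin 3 → ℝ) : 0 ≤ stackTension f n :=
  le_ciInf fun τ => stackPhi_nonneg f n τ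

/-- The tension of the zero normal vanishes. -/
theorem stackTension_zero_right (f : ℝ) : stackTension f 0 = 0 := by
  refine le_antisymm ?_ (stackTension_nonneg f 0)
  refine (stackTension_le_stackPhi f 0 0).trans (le_of_eq ?_)
  simp [stackPhi, dot3]

/-- A point of `W_f` pairs with every normal below the tension: `u·n ≤ φ_f(n)`. -/
theorem dot3_le_stackTension {f : ℝ} {u : Fin 3 → ℝ} (hu : u ∈ stackWulff f) (n : Fin 3 → ℝ) :
    dot3 u n ≤ stackTension f n :=
  le_ciInf fun τ => hu n τ

/-! ### The modulus of continuity -/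

/-- `|x + s| ≤ |x' + s| + |x − x'|`. -/
theorem abs_add_le_abs_add_add (x x' s : ℝ) : |x + s| ≤ |x' + s| + |x - x'| := by
  have h := abs_add_le (x' + s) (x - x')
  rwa [show x' + s + (x - x') = x + s by ring] at h

/-- `|x − s| ≤ |x' − s| + |x − x'|`. -/
theorem abs_sub_le_abs_sub_add (x x' s : ℝ) : |x - s| ≤ |x' - s| + |x - x'| := by
  have h := abs_add_le (x' - s) (x - x')
  rwa [show x' - s + (x - x') = x - s by ring] at h

/-- `|x| ≤ |x'| + |x − x'|`. -/
theorem abs_le_abs_add_abs_sub (x x' : ℝ) : |x| ≤ |x'| + |x - x'| := by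
  have h := abs_add_le x' (x - x')
  rwa [show x' + (x - x') = x by ring] at h

/-- `|p| + |m| ≤ |p + s| + |m − s|` as soon as one of `p`, `m` vanishes. -/
theorem abs_add_abs_le_of_zero {p m : ℝ} (h : p = 0 ∨ m = 0) (s : ℝ) :
    |p| + |m| ≤ |p + s| + |m - s| := by
  rcases h with rfl | rfl
  · have h1 := abs_add_le (m - s) s
    rw [sub_add_cancel] at h1
    rw [abs_zero, zero_add, zero_add, abs_sub_comm m s] at *
    rw [abs_sub_comm] at h1
    linarith [abs_sub_comm m s]
  · have h1 := abs_add_le (p + s) (-s)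
    rw [add_neg_cancel_right, abs_neg] at h1
    rw [abs_zero, add_zero, zero_sub, abs_neg]
    exact h1

/-- Same corrector slope `s = (1−f) f τ = (1−f') f' τ'`: the cell functions differ by at most the
explicit modulus (termwise triangle inequality, uniformly in `s`). -/
theorem stackPhi_le_of_slope_eq {f f' τ τ' : ℝ} (n n' : Fin 3 → ℝ)
    (h : (1 - f) * f * τ = (1 - f') * f' * τ') :
    stackPhi f n τ ≤ stackPhi f' n' τ' +
      ∑ i : Fin 3, (|dot3 n (aVec i) - dot3 n' (aVec i)| +
        |(1 - f) * dot3 n (bPlus i) - (1 - f') * dot3 n' (bPlus i)| +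
        |f * dot3 n (bMinus i) - f' * dot3 n' (bMinus i)|) := by
  unfold stackPhi
  simp only [h]
  have s1 := Finset.sum_le_sum fun i (_ : i ∈ (Finset.univ : Finset (Fin 3))) =>
    abs_le_abs_add_abs_sub (dot3 n (aVec i)) (dot3 n' (aVec i))
  have s2 := Finset.sum_le_sum fun i (_ : i ∈ (Finset.univ : Finset (Fin 3))) =>
    abs_add_le_abs_add_add ((1 - f) * dot3 n (bPlus i)) ((1 - f') * dot3 n' (bPlus i))
      ((1 - f') * f' * τ')
  have s3 := Finset.sum_le_sum fun i (_ : i ∈ (Finset.univ : Finset (Fin 3))) =>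
    abs_sub_le_abs_sub_add (f * dot3 n (bMinus i)) (f' * dot3 n' (bMinus i))
      ((1 - f') * f' * τ')
  simp only [Finset.sum_add_distrib] at s1 s2 s3 ⊢
  linarith

/-- Degenerate density (`(1−f) f = 0`, i.e. `f ∈ {0,1}`, where `Φ_f` does not depend on `τ`):
the cell function is still below every `Φ_{f'}(n', τ')` plus the modulus. -/
theorem stackPhi_le_of_degenerate {f : ℝ} (hf : (1 - f) * f = 0) (f' τ τ' : ℝ)
    (n n' : Fin 3 → ℝ) :
    stackPhi f n τ ≤ stackPhi f' n' τ' +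
      ∑ i : Fin 3, (|dot3 n (aVec i) - dot3 n' (aVec i)| +
        |(1 - f) * dot3 n (bPlus i) - (1 - f') * dot3 n' (bPlus i)| +
        |f * dot3 n (bMinus i) - f' * dot3 n' (bMinus i)|) := by
  have hτ : (1 - f) * f * τ = 0 := by rw [hf, zero_mul]
  have hpm : ∀ i : Fin 3, (1 - f) * dot3 n (bPlus i) = 0 ∨ f * dot3 n (bMinus i) = 0 := by
    intro i
    rcases mul_eq_zero.1 hf with h1 | h0
    · exact Or.inl (by rw [h1, zero_mul])
    · exact Or.inr (by rw [h0, zero_mul])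
  unfold stackPhi
  simp only [hτ, add_zero, sub_zero]
  -- step 1: reinsert the slope `s' = (1-f') f' τ'` on the left
  have s0 := Finset.sum_le_sum fun i (_ : i ∈ (Finset.univ : Finset (Fin 3))) =>
    abs_add_abs_le_of_zero (hpm i) ((1 - f') * f' * τ')
  -- step 2: termwise triangle inequalities
  have s1 := Finset.sum_le_sum fun i (_ : i ∈ (Finset.univ : Finset (Fin 3))) =>
    abs_le_abs_add_abs_sub (dot3 n (aVec i)) (dot3 n' (aVec i))
  have s2 := Finset.sum_le_sum fun i (_ : i ∈ (Finset.univ : Finset (Fin 3))) =>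
    abs_add_le_abs_add_add ((1 - f) * dot3 n (bPlus i)) ((1 - f') * dot3 n' (bPlus i))
      ((1 - f') * f' * τ')
  have s3 := Finset.sum_le_sum fun i (_ : i ∈ (Finset.univ : Finset (Fin 3))) =>
    abs_sub_le_abs_sub_add (f * dot3 n (bMinus i)) (f' * dot3 n' (bMinus i))
      ((1 - f') * f' * τ')
  simp only [Finset.sum_add_distrib] at s0 s1 s2 s3 ⊢
  linarith

/-- **Modulus of continuity of the tension.**
`φ_f(n) ≤ φ_{f'}(n') + Σᵢ (|n·aᵢ − n'·aᵢ| + |(1−f) n·b⁺ᵢ − (1−f') n'·b⁺ᵢ| + |f n·b⁻ᵢ − f' n'·b⁻ᵢ|)`. -/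
theorem stackTension_le_stackTension_add (f f' : ℝ) (n n' : Fin 3 → ℝ) :
    stackTension f n ≤ stackTension f' n' +
      ∑ i : Fin 3, (|dot3 n (aVec i) - dot3 n' (aVec i)| +
        |(1 - f) * dot3 n (bPlus i) - (1 - f') * dot3 n' (bPlus i)| +
        |f * dot3 n (bMinus i) - f' * dot3 n' (bMinus i)|) := by
  have key : ∀ τ' : ℝ, stackTension f n ≤ stackPhi f' n' τ' +
      ∑ i : Fin 3, (|dot3 n (aVec i) - dot3 n' (aVec i)| +
        |(1 - f) * dot3 n (bPlus i) - (1 - f') * dot3 n' (bPlus i)| +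
        |f * dot3 n (bMinus i) - f' * dot3 n' (bMinus i)|) := by
    intro τ'
    by_cases h : (1 - f) * f = 0
    · exact (stackTension_le_stackPhi f n 0).trans (stackPhi_le_of_degenerate h f' 0 τ' n n')
    · have hτ : (1 - f) * f * ((1 - f') * f' * τ' / ((1 - f) * f)) = (1 - f') * f' * τ' := by
        rw [mul_comm]
        exact div_mul_cancel₀ _ h
      exact (stackTension_le_stackPhi f n _).trans (stackPhi_le_of_slope_eq n n' hτ)
  have h2 : stackTension f n - ∑ i : Fin 3, (|dot3 n (aVec i) - dot3 n' (aVec i)| +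
        |(1 - f) * dot3 n (bPlus i) - (1 - f') * dot3 n' (bPlus i)| +
        |f * dot3 n (bMinus i) - f' * dot3 n' (bMinus i)|) ≤ stackTension f' n' :=
    le_ciInf fun τ' => by linarith [key τ']
  linarith

/-- **Joint continuity of the homogenised stacking tension** `(f, n) ↦ φ_f(n)` on `ℝ × ℝ³`. -/
theorem continuous_stackTension :
    Continuous fun p : ℝ × (Fin 3 → ℝ) => stackTension p.1 p.2 := by
  refine continuous_iff_continuousAt.2 fun p => ?_
  rw [ContinuousAt, Metric.tendsto_nhds]
  intro ε hε
  have hE : Continuous fun q : ℝ × (Fin 3 → ℝ) =>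
      ∑ i : Fin 3, (|dot3 q.2 (aVec i) - dot3 p.2 (aVec i)| +
        |(1 - q.1) * dot3 q.2 (bPlus i) - (1 - p.1) * dot3 p.2 (bPlus i)| +
        |q.1 * dot3 q.2 (bMinus i) - p.1 * dot3 p.2 (bMinus i)|) := by
    unfold dot3
    fun_prop
  have hev : ∀ᶠ q in 𝓝 p,
      ∑ i : Fin 3, (|dot3 q.2 (aVec i) - dot3 p.2 (aVec i)| +
        |(1 - q.1) * dot3 q.2 (bPlus i) - (1 - p.1) * dot3 p.2 (bPlus i)| +
        |q.1 * dot3 q.2 (bMinus i) - p.1 * dot3 p.2 (bMinus i)|) < ε := by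
    have ht := hE.tendsto p
    simp only [sub_self, abs_zero, add_zero, Finset.sum_const_zero] at ht
    exact ht.eventually (Iio_mem_nhds hε)
  filter_upwards [hev] with q hq
  rw [Real.dist_eq, abs_sub_lt_iff]
  have h1 := stackTension_le_stackTension_add q.1 p.1 q.2 p.2
  have h2 := stackTension_le_stackTension_add p.1 q.1 p.2 q.2
  have hsymm : ∑ i : Fin 3, (|dot3 p.2 (aVec i) - dot3 q.2 (aVec i)| +
        |(1 - p.1) * dot3 p.2 (bPlus i) - (1 - q.1) * dot3 q.2 (bPlus i)| +
        |p.1 * dot3 p.2 (bMinus i) - q.1 * dot3 q.2 (bMinus i)|) =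
      ∑ i : Fin 3, (|dot3 q.2 (aVec i) - dot3 p.2 (aVec i)| +
        |(1 - q.1) * dot3 q.2 (bPlus i) - (1 - p.1) * dot3 p.2 (bPlus i)| +
        |q.1 * dot3 q.2 (bMinus i) - p.1 * dot3 p.2 (bMinus i)|) :=
    Finset.sum_congr rfl fun i _ => by
      rw [abs_sub_comm (dot3 p.2 (aVec i)), abs_sub_comm ((1 - p.1) * dot3 p.2 (bPlus i)),
        abs_sub_comm (p.1 * dot3 p.2 (bMinus i))]
  rw [hsymm] at h2
  constructor <;> linarith

/-- Continuity of `y ↦ φ_{g(y)}(v(y))` for continuous data (the integrand of the modulated total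
variation). -/
theorem continuous_stackTension_comp {X : Type*} [TopologicalSpace X] {g : X → ℝ}
    {v : X → Fin 3 → ℝ} (hg : Continuous g) (hv : Continuous v) :
    Continuous fun x => stackTension (g x) (v x) := by
  have h1 : Continuous fun x => (g x, v x) := hg.prodMk hv
  exact (continuous_stackTension.comp h1).congr fun x => rfl

/-! ### `W_f` is bounded (`f ∈ [0,1]`) -/

/-- `e_j · v = v j`. -/
theorem dot3_single_left (j : Fin 3) (c : ℝ) (v : Fin 3 → ℝ) :
    dot3 (Pi.single j c) v = c * v j := by
  fin_cases j <;> simp [dot3]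

/-- `u · e_j = u j`. -/
theorem dot3_single_right (u : Fin 3 → ℝ) (j : Fin 3) (c : ℝ) :
    dot3 u (Pi.single j c) = c * u j := by
  fin_cases j <;> simp [dot3] <;> ring

/-- `√3 ≤ 2`. -/
theorem sqrt_three_le_two : Real.sqrt 3 ≤ 2 := by
  rw [show (2 : ℝ) = Real.sqrt (2 ^ 2) by rw [Real.sqrt_sq (by norm_num)]]
  exact Real.sqrt_le_sqrt (by norm_num)

/-- All frame vectors have coordinates of modulus at most `1`. -/
theorem abs_frame_le_one (i j : Fin 3) :
    |aVec i j| ≤ 1 ∧ |bPlus i j| ≤ 1 ∧ |bMinus i j| ≤ 1 := by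
  have h3 : Real.sqrt 3 ≤ 2 := sqrt_three_le_two
  have h3' : 0 ≤ Real.sqrt 3 := Real.sqrt_nonneg 3
  have h23 : Real.sqrt (2 / 3) ≤ 1 := Real.sqrt_le_one.2 (by norm_num)
  have h23' : 0 ≤ Real.sqrt (2 / 3) := Real.sqrt_nonneg _
  fin_cases i <;> fin_cases j <;>
    simp only [aVec, bPlus, bMinus, Fin.isValue, Matrix.cons_val_zero, Matrix.cons_val_one,
      Matrix.cons_val, Fin.zero_eta, Fin.mk_one, Fin.reduceFinMk, abs_le] <;>
    (refine ⟨⟨?_, ?_⟩, ⟨?_, ?_⟩, ⟨?_, ?_⟩⟩ <;> nlinarith)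

/-- The cell function at a signed coordinate normal is at most `9` (for `f ∈ [0,1]`). -/
theorem stackPhi_single_le_nine {f : ℝ} (hf0 : 0 ≤ f) (hf1 : f ≤ 1) (j : Fin 3) {c : ℝ}
    (hc : |c| = 1) : stackPhi f (Pi.single j c) 0 ≤ 9 := by
  unfold stackPhi
  simp only [dot3_single_left, mul_zero, add_zero, sub_zero]
  have hb : ∀ i : Fin 3, |c * aVec i j| + |(1 - f) * (c * bPlus i j)| + |f * (c * bMinus i j)| ≤ 3 := by
    intro i
    obtain ⟨ha, hp, hm⟩ := abs_frame_le_one i j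
    simp only [abs_mul, hc, one_mul]
    rw [abs_of_nonneg (by linarith : (0 : ℝ) ≤ 1 - f), abs_of_nonneg hf0]
    nlinarith [abs_nonneg (bPlus i j), abs_nonneg (bMinus i j)]
  have := Finset.sum_le_sum fun i (_ : i ∈ (Finset.univ : Finset (Fin 3))) => hb i
  simp only [Finset.sum_add_distrib, Finset.sum_const, Finset.card_univ, Fintype.card_fin,
    nsmul_eq_mul, Nat.cast_ofNat] at this ⊢
  linarith

/-- **`W_f ⊆ B̄_∞(0, 9)` for `f ∈ [0,1]`**: every coordinate of a point of the stacking Wulff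
body has modulus at most `9` (crude, from the coordinate normals `±e_j` at slope `0`). -/
theorem norm_le_nine_of_mem_stackWulff {f : ℝ} (hf0 : 0 ≤ f) (hf1 : f ≤ 1) {u : Fin 3 → ℝ}
    (hu : u ∈ stackWulff f) : ‖u‖ ≤ 9 := by
  rw [pi_norm_le_iff_of_nonneg (by norm_num)]
  intro j
  rw [Real.norm_eq_abs, abs_le]
  constructor
  · have h := hu (Pi.single j (-1)) 0
    rw [dot3_single_right] at h
    have h9 := stackPhi_single_le_nine hf0 hf1 j (c := -1) (by simp)
    linarith
  · have h := hu (Pi.single j 1) 0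
    rw [dot3_single_right] at h
    have h9 := stackPhi_single_le_nine hf0 hf1 j (c := 1) (by simp)
    linarith

end Summit.Ventures.Crystal3D.Theorems.ModulatedWulff

end
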